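import Mathlib
import Summits.KontsevichZagierPeriods.Zeta5Search.BrickLevelReductionTwo

/-!
# BrickTwistedHarmonicLawsTwo — the residue laws and the ONE-LEVEL REDUCTION at the prime `2` for the `C`-TWISTED HARMONIC CELLS
`Z̃^{(w,C)}_K(n) = Σ_s w_s·c̃_{K,s}(n)·H_K^{(s+C)}` of the centre-free brick kernel (cell `pub-zeta5`, seat ct-1 g45; the twisted
form of ct-1 g42's `BrickResidueLawTwoZero` / `BrickHoleResidueLawTwo.residueLawZero_two_hat` / `BrickLevelReductionTwo.…_zero`)

HONEST FRAMING: systematic search; no irrationality claim unless certified.  `2`-ADIC BOOKKEEPING of the twisted harmonic cells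
(`w` any `2`-integral weights, `C ≥ 0`; written out in full, no definition) of the centre-free brick kernels
`R̃_n(t) = n!^{A−2B}(t−n)_n^B(t+n+1)_n^B/(t)_{n+1}^A`; nothing about `ζ(5)`; no `γ` / record statement; records in print UNMOVED;
NOTHING IS DISCHARGED.  Theorems only (0 `def`).

WHY: as at odd primes (`BrickTwistedHarmonicLaws`), every harmonic-cell law at `2` is termwise in `s`: ct-1 g42's generic step
`BrickResidueLawTwoZero.residueLawZero_of_depth` (depth laws for all `d` + a `2`-integral multiplier ⇒ harmonic law) runs verbatim
with `H^{(s+C)}` and a factor `w_s`.  CONSUMER: ct-1 g45's `BrickTwistedHarmonicTwo` (PROPOSITION H at `2` for `Z̃^{(w,C)}`) and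
`BrickDenominatorsAllCTwo` (Krattenthaler–Rivoal's Théorème 1 (ii) for every `C` at the prime `2`).

* `residueLawTwist_of_depth_two` — the generic step;
* `level_reduction_two_odd_twist`, `level_reduction_two_even_twist` — the one-level reductions (odd row `2N+1`; even row `2N+2`
  with the hole row `N`), weights `W = blockWeight`, `G = holeWeight` exactly as in ct-1 g42's file.
-/

namespace Summit.KontsevichZagierPeriods.Zeta5Search.BrickTwistedHarmonicLawsTwo

open Finset Nat Polynomial WithZero
open Summit.KontsevichZagierPeriods.Zeta5Search.BrickTopCoefficient (cTop)
open Summit.KontsevichZagierPeriods.Zeta5Search.BrickLaurent (expandAt laurent cell phiCoeff)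
open Summit.KontsevichZagierPeriods.Zeta5Search.ScaledSeries (IsSlopeInt)
open Summit.KontsevichZagierPeriods.Zeta5Search.BrickHarmonicBlocks (hsum)
open Summit.KontsevichZagierPeriods.Zeta5Search.BrickLambda (le_one_of_cong cTop_zero_ne_zero)
open Summit.KontsevichZagierPeriods.Zeta5Search.BrickResidueLawMain (cong_mul_le level_hsum_sub_le level_hsum_integral)
open Summit.KontsevichZagierPeriods.Zeta5Search.BrickPhiAllPrimes (padicValuation_phiCoeff_zero_eq_one)
open Summit.KontsevichZagierPeriods.Zeta5Search.BrickFrobeniusTwoOddRow (isSlopeInt_psiSeries)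
open Summit.KontsevichZagierPeriods.Zeta5Search.BrickFrobeniusTwoOddRowEven (isSlopeInt_psi'Series)
open Summit.KontsevichZagierPeriods.Zeta5Search.BrickHatTwoCells (isSlopeInt_hatSeries)
open Summit.KontsevichZagierPeriods.Zeta5Search.BrickLevelReduction (blockWeight)
open Summit.KontsevichZagierPeriods.Zeta5Search.BrickHoleWeight (holeWeight)
open Summit.KontsevichZagierPeriods.Zeta5Search.BrickResidueLawTwo (residueLaw_two_even residueLaw_two_odd_odd
  residueLaw_two_odd_even cTop_two_even cTop_two_odd_odd cTop_two_odd_even padicValuation_two_pow)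
open Summit.KontsevichZagierPeriods.Zeta5Search.BrickResidueLawTwoZero (level_laurent_integral_two)
open Summit.KontsevichZagierPeriods.Zeta5Search.BrickHoleResidueLawTwo (residueLaw_two_hat cTop_two_hat)
open Summit.KontsevichZagierPeriods.Zeta5Search.BrickLevelReductionTwo (sum_range_even_odd sum_range_even_odd_succ term_le)

noncomputable section

/-! ## The generic step -/

/-- **The generic step, twisted**: a residue law at every depth `d` with a `2`-integral multiplier `λ` (`K ≤ N < 2^{L+1}`, `2B ≤ A`,
`⌊j/2⌋ = K`) implies, for `2`-integral weights `w` and any shift `C`,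
`v₂(2^{(L+1)(A+C)}·Z̃^{(w,C)}_j(n) − λ·2^{L(A+C)}·Z̃^{(w,C)}_K(N)) ≤ exp(−(L+1))`. -/
theorem residueLawTwist_of_depth_two {A B : ℕ} (hAB : 2 * B ≤ A) {L N K n j : ℕ} (hN : N < 2 ^ (L + 1)) (hK : K ≤ N)
    (hjK : j / 2 = K) {lam : ℚ}
    (hlaw : ∀ d, Rat.padicValuation 2 ((2 : ℚ) ^ ((L + 1) * d) * laurent A B 0 n j d -
      lam * ((2 : ℚ) ^ (L * d) * laurent A B 0 N K d)) ≤ exp (-((L : ℤ) + 1)))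
    (hlam : Rat.padicValuation 2 lam ≤ 1) {C : ℕ} {w : ℕ → ℚ} (hw : ∀ s, Rat.padicValuation 2 (w s) ≤ 1) :
    Rat.padicValuation 2 ((2 : ℚ) ^ ((L + 1) * (A + C)) * ∑ s ∈ Icc 1 A, w s * (cell A B 0 n j s * hsum (s + C) j) -
      lam * ((2 : ℚ) ^ (L * (A + C)) * ∑ s ∈ Icc 1 A, w s * (cell A B 0 N K s * hsum (s + C) K))) ≤
      exp (-((L : ℤ) + 1)) := by
  have hJlt : K < 2 ^ (L + 1) := lt_of_le_of_lt hK hN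
  have hlt1 : exp (-((L : ℤ) + 1)) < 1 := by rw [← exp_zero, exp_lt_exp]; omega
  have hsplit : ∀ m : ℕ, ∀ s ∈ Icc 1 A, (2 : ℚ) ^ (m * (A + C)) = (2 : ℚ) ^ (m * (A - s)) * (2 : ℚ) ^ (m * (s + C)) :=
    fun m s hs => by rw [← pow_add, ← mul_add]; congr 2; have := (mem_Icc.1 hs).2; omega
  have hx : (2 : ℚ) ^ ((L + 1) * (A + C)) * ∑ s ∈ Icc 1 A, w s * (cell A B 0 n j s * hsum (s + C) j) =
      ∑ s ∈ Icc 1 A, w s * ((((2 : ℚ) ^ ((L + 1) * (A - s)) * cell A B 0 n j s)) *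
        ((2 : ℚ) ^ ((L + 1) * (s + C)) * hsum (s + C) j)) := by
    rw [Finset.mul_sum]
    exact Finset.sum_congr rfl fun s hs => by rw [hsplit (L + 1) s hs]; ring
  have hy : lam * ((2 : ℚ) ^ (L * (A + C)) * ∑ s ∈ Icc 1 A, w s * (cell A B 0 N K s * hsum (s + C) K)) =
      ∑ s ∈ Icc 1 A, w s * ((lam * ((2 : ℚ) ^ (L * (A - s)) * cell A B 0 N K s)) *
        ((2 : ℚ) ^ (L * (s + C)) * hsum (s + C) K)) := by
    rw [Finset.mul_sum, Finset.mul_sum]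
    exact Finset.sum_congr rfl fun s hs => by rw [hsplit L s hs]; ring
  rw [hx, hy, ← Finset.sum_sub_distrib]
  refine Valuation.map_sum_le _ fun s hs => ?_
  have hs' := mem_Icc.1 hs
  rw [← mul_sub, map_mul]
  refine (mul_le_mul' (hw s) ?_).trans (by rw [one_mul])
  have hlaw' : Rat.padicValuation 2 ((2 : ℚ) ^ ((L + 1) * (A - s)) * cell A B 0 n j s -
      lam * ((2 : ℚ) ^ (L * (A - s)) * cell A B 0 N K s)) ≤ exp (-((L : ℤ) + 1)) := hlaw (A - s)
  have hH := level_hsum_sub_le (p := 2) (show 1 ≤ s + C by omega) L j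
  rw [hjK, show (((2 : ℕ) : ℚ)) = (2 : ℚ) by norm_num] at hH
  have hy₁ : Rat.padicValuation 2 (lam * ((2 : ℚ) ^ (L * (A - s)) * cell A B 0 N K s)) ≤ 1 := by
    rw [map_mul]; exact mul_le_one' hlam (level_laurent_integral_two hAB hN hK (A - s))
  exact cong_mul_le hlaw' hH (le_one_of_cong (lt_of_le_of_lt hlaw' hlt1) hy₁) (level_hsum_integral hJlt (s + C))

/-! ## Odd row `2N+1` -/

section odd

variable {A B : ℕ} (hAB : 2 * B ≤ A) (hB : 1 ≤ B) {L N : ℕ} (hN : N < 2 ^ (L + 1)) {g : ℕ → ℚ}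
  (hg : ∀ k, k ≤ 2 * N + 1 → Rat.padicValuation 2 (g k) ≤ 1) {C : ℕ} {w : ℕ → ℚ} (hw : ∀ s, Rat.padicValuation 2 (w s) ≤ 1)
include hAB hB hN hg hw

/-- **ONE-LEVEL REDUCTION at `2`, odd row, twisted harmonic cell** (`W = blockWeight A B 0 2 1 N g`):
`v₂(Σ_{k<2N+2} g(k)·2^{(L+1)(A+C)}Z̃_k^{(2N+1)} − Σ_{K<N+1} W(K)·2^{L(A+C)}Z̃_K^{(N)}) ≤ exp(−(L+1))`. -/
theorem level_reduction_two_odd_twist :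
    Rat.padicValuation 2 (∑ k ∈ range (2 * N + 1 + 1), g k * ((2 : ℚ) ^ ((L + 1) * (A + C)) *
        ∑ s ∈ Icc 1 A, w s * (cell A B 0 (2 * N + 1) k s * hsum (s + C) k)) -
      ∑ K ∈ range (N + 1), blockWeight A B 0 2 1 N g K * ((2 : ℚ) ^ (L * (A + C)) *
        ∑ s ∈ Icc 1 A, w s * (cell A B 0 N K s * hsum (s + C) K))) ≤ exp (-((L : ℤ) + 1)) := by
  rw [sum_range_even_odd, ← Finset.sum_add_distrib, ← Finset.sum_sub_distrib]
  refine Valuation.map_sum_le _ fun K hK => ?_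
  have hKN : K ≤ N := Nat.lt_succ_iff.1 (mem_range.1 hK)
  have hc0 : cTop A B 0 N K ≠ 0 := cTop_zero_ne_zero hKN A B
  have hW : blockWeight A B 0 2 1 N g K =
      g (2 * K) * (cTop A B 0 (2 * N + 1) (2 * K) / cTop A B 0 N K) +
        g (2 * K + 1) * (cTop A B 0 (2 * N + 1) (2 * K + 1) / cTop A B 0 N K) := by
    rw [blockWeight, Finset.sum_range_succ, Finset.sum_range_one, zero_add, show 1 + N * 2 = 2 * N + 1 by ring,
      show K * 2 = 2 * K by ring, show 1 + 2 * K = 2 * K + 1 by ring]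
  rw [hW, cTop_two_odd_even hAB hKN, cTop_two_odd_odd hAB hKN, mul_div_cancel_right₀ _ hc0, mul_div_cancel_right₀ _ hc0]
  have he := residueLawTwist_of_depth_two hAB hN hKN (by omega) (residueLaw_two_odd_even hAB hB hN hKN) (by
    have h0 := isSlopeInt_psi'Series A B N K 0
    rw [zero_mul, zero_add, exp_zero] at h0
    rw [map_mul, padicValuation_two_pow]
    exact mul_le_one' (by rw [← exp_zero, exp_le_exp]; omega) h0) (C := C) hw
  have ho := residueLawTwist_of_depth_two hAB hN hKN (by omega) (residueLaw_two_odd_odd hAB hB hN hKN) (by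
    have h0 := isSlopeInt_psiSeries A B N K 0
    rw [zero_mul, zero_add, exp_zero] at h0
    rw [map_mul, padicValuation_two_pow]
    exact mul_le_one' (by rw [← exp_zero, exp_le_exp]; omega) h0) (C := C) hw
  have h1 := term_le (hg (2 * K) (by omega)) he
  have h2 := term_le (hg (2 * K + 1) (by omega)) ho
  rw [show ∀ (a b c e f : ℚ), a + b - (c + e) * f = (a - c * f) + (b - e * f) from fun a b c e f => by ring]
  exact (Valuation.map_add _ _ _).trans (max_le h1 h2)

end odd

/-! ## Even row `2N+2` -/

section even

variable {A B : ℕ} (hAB : 2 * B ≤ A) {L N : ℕ} (hN : N + 1 < 2 ^ (L + 1)) {g : ℕ → ℚ}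
  (hg : ∀ k, k ≤ 2 * N + 2 → Rat.padicValuation 2 (g k) ≤ 1) {C : ℕ} {w : ℕ → ℚ} (hw : ∀ s, Rat.padicValuation 2 (w s) ≤ 1)
include hAB hN hg hw

/-- **ONE-LEVEL REDUCTION at `2`, even row, twisted harmonic cell** (`W = blockWeight A B 0 2 0 (N+1) g`, `G = holeWeight A B 0 2 0 N g`,
`1 ≤ A`): `v₂(Σ_{k<2N+3} g(k)·2^{(L+1)(A+C)}Z̃_k^{(2N+2)} − Σ_{K<N+2} W(K)·2^{L(A+C)}Z̃_K^{(N+1)} − Σ_{K<N+1} G(K)·2^{L(A+C)}Z̃_K^{(N)})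
≤ exp(−(L+1))`. -/
theorem level_reduction_two_even_twist (hA : 1 ≤ A) :
    Rat.padicValuation 2 (∑ k ∈ range (2 * N + 2 + 1), g k * ((2 : ℚ) ^ ((L + 1) * (A + C)) *
        ∑ s ∈ Icc 1 A, w s * (cell A B 0 (2 * N + 2) k s * hsum (s + C) k)) -
      ∑ K ∈ range (N + 1 + 1), blockWeight A B 0 2 0 (N + 1) g K * ((2 : ℚ) ^ (L * (A + C)) *
        ∑ s ∈ Icc 1 A, w s * (cell A B 0 (N + 1) K s * hsum (s + C) K)) -
      ∑ K ∈ range (N + 1), holeWeight A B 0 2 0 N g K * ((2 : ℚ) ^ (L * (A + C)) *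
        ∑ s ∈ Icc 1 A, w s * (cell A B 0 N K s * hsum (s + C) K))) ≤ exp (-((L : ℤ) + 1)) := by
  have hN' : N < 2 ^ (L + 1) := by omega
  rw [sum_range_even_odd_succ, show ∀ (a b c e : ℚ), a + b - c - e = (a - c) + (b - e) from fun a b c e => by ring,
    ← Finset.sum_sub_distrib, ← Finset.sum_sub_distrib]
  refine (Valuation.map_add _ _ _).trans (max_le (Valuation.map_sum_le _ fun K hK => ?_)
    (Valuation.map_sum_le _ fun K hK => ?_))
  · -- ° cell `2K` against the row `N+1`
    have hKN : K ≤ N + 1 := Nat.lt_succ_iff.1 (mem_range.1 hK)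
    have hc0 : cTop A B 0 (N + 1) K ≠ 0 := cTop_zero_ne_zero hKN A B
    have hW : blockWeight A B 0 2 0 (N + 1) g K = g (2 * K) * (cTop A B 0 ((N + 1) * 2) (K * 2) / cTop A B 0 (N + 1) K) := by
      rw [blockWeight, Finset.sum_range_one, zero_add, zero_add, show K * 2 = 2 * K by ring]
    rw [hW, cTop_two_even hAB hKN, mul_div_cancel_right₀ _ hc0]
    have he := residueLawTwist_of_depth_two hAB hN hKN (Nat.mul_div_cancel K two_pos) (residueLaw_two_even hAB hN hKN) (by
      rw [map_mul, map_pow, Valuation.map_neg, map_one, one_pow, one_mul, padicValuation_phiCoeff_zero_eq_one]) (C := C) hw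
    rw [show (N + 1) * 2 = 2 * N + 2 by ring, show K * 2 = 2 * K by ring] at he
    exact term_le (hg (2 * K) (by omega)) he
  · -- hole `2K+1` against the row `N`
    have hKN : K ≤ N := Nat.lt_succ_iff.1 (mem_range.1 hK)
    have hc0 : cTop A B 0 N K ≠ 0 := cTop_zero_ne_zero hKN A B
    have hG : holeWeight A B 0 2 0 N g K = g (2 * K + 1) * (cTop A B 0 (2 * N + 2) (2 * K + 1) / cTop A B 0 N K) := by
      rw [holeWeight, zero_add, Nat.Ico_succ_singleton, Finset.sum_singleton, zero_add, show (N + 1) * 2 = 2 * N + 2 by ring,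
        show 1 + K * 2 = 2 * K + 1 by ring]
    rw [hG, cTop_two_hat hAB hKN, mul_div_cancel_right₀ _ hc0]
    have hh := residueLawTwist_of_depth_two hAB hN' hKN (by omega) (residueLaw_two_hat hAB hN' hKN hA) (by
      have h0 := isSlopeInt_hatSeries A B N K 0
      rw [zero_mul, zero_add, exp_zero] at h0
      rw [map_mul, padicValuation_two_pow]
      exact mul_le_one' (by rw [← exp_zero, exp_le_exp]; omega) h0) (C := C) hw
    exact term_le (hg (2 * K + 1) (by omega)) hh

end even

end

end Summit.KontsevichZagierPeriods.Zeta5Search.BrickTwistedHarmonicLawsTwo
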